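import Summits.QuantumFields.QCD.Theorems.QuarksAsStableActionStableActionBridgeDefs
import Literature.MathematicalPhysics.QuantumFieldTheory.MassGapFromLatticeClustering
import HarnessLib

/-!
# Crux `ChiralGluonicCompletion` (stmt-QuantumFields-17498), line `goldstone_split` — packaging abbreviations for the
# lattice-side input bundle of child `PackageContinuum` (lead c10, rev 4, 2026-08-17)

Route-posited packaging objects (no mathematics): the registered stubs of the line must be one-line `Prop` terms of at
most 3900 characters (`ledger skeleton check` truncates longer signatures; `workitem stub-add` refuses > 4000), while the
engine-shaped lattice-side inputs of child `PackageContinuum` — copied verbatim from the hypotheses of the scheme-generic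
OS engine `exists_osData_qcd_of_package` (`Theorems/QuarksAsStableActionStableActionBridgeSoftClosureQCD.lean`) with
`Λ k := qcdLatticeDist (reg.scheme m z shift) k` — run to ~6000.  The three REDUCIBLE abbreviations below carry those
conjuncts verbatim, so that

* `stub_packageLatticeInputs` (OPEN physics for the GIVEN regularisation: mass-equicontinuous species data, k-eventual
  bounds on a countable test family, and per tuple `LatticeExtInputs ∧ LatticeSideInputs`) and
* `stub_compactnessReady_of_latticeInputs` (the engine step, proved by the wave-1 stub-worker: inputs ⇒ per tuple
  `CompactnessClosure`, the closure clause consumed by the landed diagonal step p163529)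

are registrable and landable `--supports stmt-QuantumFields-17498`.  `CompactnessClosure … ↔` the unpackaged closure
clause of `stub_packageContinuum_of_compactnessReady` is `Iff.rfl`.

Contents of the bundle, for the reader: (EXT) along every strictly increasing `φ` on which the countable family
converges, all `qcdLatticeDist sch (φ k) n σ F`, `F ∈ ⁰𝒮`, converge; (T) k-uniform E0′ bound on `⁰𝒮` (engine P2);
(RP) eventually approximately positive OS forms (P8); (CL) k-uniform spatial clustering (P9); (CS+GAP) species
Cauchy–Schwarz clustering and the lattice gap at one rate `Δ > 0` (P10); (FLOORS) eventual lower bounds on the glue and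
flavour-changing pseudoscalar truncated two-point functions and on `κ₃(glue)` (P11 ×3); (E1) every subsequential limit
of the lattice `n`-point functions on off-diagonal real tensors is invariant under proper rotations.
References: Osterwalder–Schrader II, CMP 42 (1975) §2, §4; Glimm–Jaffe, *Quantum Physics* (1987) §6.1.
-/

noncomputable section

namespace Summit.QuantumFields.QCD.Theorems.GoldstoneSplit

open scoped SchwartzMap Topology
open MeasureTheory Filter
open Literature.MathematicalPhysics.QuantumFieldTheory Literature.MathematicalPhysics.QuantumLattice
  Literature.MathematicalPhysics.AQFT Literature.Probability.LatticeModels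
open Summit.QuantumFields.QCD.Cruxes.StableActionBridge.Sketch

/-- The lattice-side inputs at the tuple `m` for `sch := reg.scheme m z shift` that are stated along the FULL sequence `k`
(T-bound, RP, CL, CS+GAP, floors ×3) plus the rotation module over all strictly increasing `φ` — conjuncts (ii)–(ix) of
`stub_packageLatticeInputs`, verbatim with `z m, shift m ↦ z, shift`. -/
abbrev LatticeSideInputs (Nf : ℕ) (reg : QCDRegularisation Nf) (m : Fin Nf → ℝ) (z shift : QCDField Nf → ℕ → ℝ) : Prop :=
  (∃ (s : ℕ) (α β : ℝ), 0 ≤ α ∧ ∀ (n' : ℕ) (σ' : Fin n' → QCDField Nf), ∀ᶠ k in atTop, ∀ F : SchwartzMap (Fin n' → EuclideanSpace ℝ (Fin 4)) ℂ, IsOffDiagonal F → ‖qcdLatticeDist (reg.scheme m z shift) k n' σ' F‖ ≤ α * (n'.factorial : ℝ) ^ β * schwartzNorm (n' * s) F) ∧ (∀ (N : ℕ) (deg : Fin N → ℕ) (lab : (j : Fin N) → Fin (deg j) → QCDField Nf) (G : (j : Fin N) → SchwartzMap (Fin (deg j) → EuclideanSpace ℝ (Fin 4)) ℂ), (∀ j,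 IsTimeOrdered (G j)) → ∀ H : (i j : Fin N) → SchwartzMap (Fin (deg i + deg j) → EuclideanSpace ℝ (Fin 4)) ℂ, (∀ i j, IsAppendTensorOf (H i j) (osAdjoint (G i)) (G j)) → ∀ ε : ℝ, 0 < ε → ∀ᶠ l in atTop, -ε ≤ (∑ i, ∑ j, qcdLatticeDist (reg.scheme m z shift) l (deg i + deg j) (Fin.append (lab i ∘ Fin.rev) (lab j)) (H i j)).re ∧ |(∑ i, ∑ j, qcdLatticeDist (reg.scheme m z shift) l (deg i + deg j) (Fin.append (lab i ∘ Fin.rev) (lab j)) (H i j)).im| ≤ ε) ∧ (∀ (n' m' : ℕ) (σ' : Fin n' → QCDField Nf) (σ'' : Fin m' → QCDField Nf) (F : SchwartzMap (Fin n' → EuclideanSpace ℝ (Fin 4)) ℂ) (G : SchwartzMap (Fin m' → EuclideanSpace ℝ (Fin 4)) ℂ), IsTimeOrdered F → IsTimeOrdered G → ∀ a : EuclideanSpace ℝ (Fin 4), a 0 = 0 → a ≠ 0 → ∀ ε : ℝ, 0 < ε → ∃ t₀ : ℝ, ∀ t : ℝ, t₀ ≤ t → ∀ H : SchwartzMap (Fin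 (n' + m') → EuclideanSpace ℝ (Fin 4)) ℂ, IsAppendTensorOf H (osAdjoint F) (translateMulti (t • a) G) → ∀ᶠ k in atTop, ‖qcdLatticeDist (reg.scheme m z shift) k (n' + m') (Fin.append (σ' ∘ Fin.rev) σ'') H - qcdLatticeDist (reg.scheme m z shift) k n' (σ' ∘ Fin.rev) (osAdjoint F) * qcdLatticeDist (reg.scheme m z shift) k m' σ'' G‖ ≤ ε) ∧ (∃ Δ : ℝ, 0 < Δ ∧ (reg.scheme m z shift).HasSpeciesCSClustering Δ ∧ (reg.scheme m z shift).HasLatticeMassGap Δ) ∧ (∃ (F G : SchwartzMap (Fin 1 → EuclideanSpace ℝ (Fin 4)) ℂ) (H : SchwartzMap (Fin (1 + 1) → EuclideanSpace ℝ (Fin 4)) ℂ), IsTimeOrdered F ∧ IsTimeOrdered G ∧ IsAppendTensorOf H (osAdjoint F) G ∧ ∃ ε : ℝ, 0 < ε ∧ ∀ᶠ k in atTop, ε ≤ ‖qcdLatticeDist (reg.scheme m z shift) k (1 + 1) (fun _ => QCDField.glue) H - qcdLatticeDist (reg.scheme m z shift) k 1 (fun _ => QCDField.glue) (osAdjoint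 F) * qcdLatticeDist (reg.scheme m z shift) k 1 (fun _ => QCDField.glue) G‖) ∧ (∀ fl gl : Fin Nf, fl ≠ gl → ∃ (F G : SchwartzMap (Fin 1 → EuclideanSpace ℝ (Fin 4)) ℂ) (H : SchwartzMap (Fin (1 + 1) → EuclideanSpace ℝ (Fin 4)) ℂ), IsTimeOrdered F ∧ IsTimeOrdered G ∧ IsAppendTensorOf H (osAdjoint F) G ∧ ∃ ε : ℝ, 0 < ε ∧ ∀ᶠ k in atTop, ε ≤ ‖qcdLatticeDist (reg.scheme m z shift) k (1 + 1) (fun _ => QCDField.pseudoRe fl gl) H - qcdLatticeDist (reg.scheme m z shift) k 1 (fun _ => QCDField.pseudoRe fl gl) (osAdjoint F) * qcdLatticeDist (reg.scheme m z shift) k 1 (fun _ => QCDField.pseudoRe fl gl) G‖) ∧ (∃ (g₁ g₂ g₃ : SchwartzMap (EuclideanSpace ℝ (Fin 4)) ℂ) (Ffgh : SchwartzMap (Fin 3 → EuclideanSpace ℝ (Fin 4)) ℂ) (Fgh Ffh Ffg : SchwartzMap (Fin 2 → EuclideanSpace ℝ (Fin 4)) ℂ) (Ff Fg Fh : SchwartzMap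 (Fin 1 → EuclideanSpace ℝ (Fin 4)) ℂ), IsTensorOf Ffgh ![g₁, g₂, g₃] ∧ IsOffDiagonal Ffgh ∧ IsTensorOf Fgh ![g₂, g₃] ∧ IsTensorOf Ffh ![g₁, g₃] ∧ IsTensorOf Ffg ![g₁, g₂] ∧ IsOffDiagonal Fgh ∧ IsOffDiagonal Ffh ∧ IsOffDiagonal Ffg ∧ IsTensorOf Ff ![g₁] ∧ IsTensorOf Fg ![g₂] ∧ IsTensorOf Fh ![g₃] ∧ ∃ ε : ℝ, 0 < ε ∧ ∀ᶠ k in atTop, ε ≤ ‖qcdLatticeDist (reg.scheme m z shift) k 3 (fun _ => QCDField.glue) Ffgh - qcdLatticeDist (reg.scheme m z shift) k 1 (fun _ => QCDField.glue) Ff * qcdLatticeDist (reg.scheme m z shift) k 2 (fun _ => QCDField.glue) Fgh - qcdLatticeDist (reg.scheme m z shift) k 1 (fun _ => QCDField.glue) Fg * qcdLatticeDist (reg.scheme m z shift) k 2 (fun _ => QCDField.glue) Ffh - qcdLatticeDist (reg.scheme m z shift) k 1 (fun _ => QCDField.glue) Fh * qcdLatticeDist (reg.scheme m z shift) k 2 (fun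 _ => QCDField.glue) Ffg + 2 * (qcdLatticeDist (reg.scheme m z shift) k 1 (fun _ => QCDField.glue) Ff * qcdLatticeDist (reg.scheme m z shift) k 1 (fun _ => QCDField.glue) Fg * qcdLatticeDist (reg.scheme m z shift) k 1 (fun _ => QCDField.glue) Fh)‖) ∧ (∀ φ : ℕ → ℕ, StrictMono φ → ∀ S : LabelledSchwingerFamily (QCDField Nf) (EuclideanSpace ℝ (Fin 4)), (∀ n' : ℕ, n' ≠ 0 → ∀ (σ' : Fin n' → QCDField Nf) (f' : Fin n' → SchwartzMap (EuclideanSpace ℝ (Fin 4)) ℝ) (F : SchwartzMap (Fin n' → EuclideanSpace ℝ (Fin 4)) ℂ), IsTensorOf F (fun i => ofRealTest (f' i)) → IsOffDiagonal F → Tendsto (fun k => qcdLatticeSchwinger (reg.scheme m z shift) (φ k) n' σ' f') atTop (𝓝 (S n' σ' F))) → ∀ (n' : ℕ) (σ' : Fin n' → QCDField Nf) (R : (EuclideanSpace ℝ (Fin 4)) ≃ₗᵢ[ℝ] (EuclideanSpace ℝ (Fin 4))), LinearMap.det (R.toLinearEquiv : (EuclideanSpace ℝ (Fin 4)) →ₗ[ℝ]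 (EuclideanSpace ℝ (Fin 4))) = 1 → ∀ F : SchwartzMap (Fin n' → EuclideanSpace ℝ (Fin 4)) ℂ, IsOffDiagonal F → S n' σ' (linActMulti R F) = S n' σ' F)

/-- (EXT) at the tuple `m` over the countable family `(n, σ, f)`: conjunct (i) of `stub_packageLatticeInputs`, verbatim. -/
abbrev LatticeExtInputs (Nf : ℕ) (reg : QCDRegularisation Nf) {ι : Type} (n : ι → ℕ) (σ : (i : ι) → Fin (n i) → QCDField Nf)
    (f : (i : ι) → Fin (n i) → SchwartzMap (EuclideanSpace ℝ (Fin 4)) ℝ) (m : Fin Nf → ℝ) (z shift : QCDField Nf → ℕ → ℝ) : Prop :=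
  (∀ φ : ℕ → ℕ, StrictMono φ → (∀ i, ∃ l : ℂ, Tendsto (fun k => qcdLatticeSchwinger (reg.scheme m z shift) (φ k) (n i) (σ i) (f i)) atTop (𝓝 l)) → ∀ (n' : ℕ) (σ' : Fin n' → QCDField Nf) (F : SchwartzMap (Fin n' → EuclideanSpace ℝ (Fin 4)) ℂ), IsOffDiagonal F → ∃ c : ℂ, Tendsto (fun k => qcdLatticeDist (reg.scheme m z shift) (φ k) n' σ' F) atTop (𝓝 c))

/-- The closure clause of the compactness-ready bundle at the tuple `m` over the family `(n, σ, f)`, verbatim. -/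
abbrev CompactnessClosure (Nf : ℕ) (reg : QCDRegularisation Nf) {ι : Type} (n : ι → ℕ) (σ : (i : ι) → Fin (n i) → QCDField Nf)
    (f : (i : ι) → Fin (n i) → SchwartzMap (EuclideanSpace ℝ (Fin 4)) ℝ) (m : Fin Nf → ℝ) (z shift : QCDField Nf → ℕ → ℝ) : Prop :=
  ∀ φ : ℕ → ℕ, StrictMono φ → (∀ i, ∃ l : ℂ, Tendsto (fun k => qcdLatticeSchwinger (reg.scheme m z shift) (φ k) (n i) (σ i) (f i)) atTop (𝓝 l)) → ∃ T : OSData (QCDField Nf) 4, (∀ n' : ℕ, n' ≠ 0 → ∀ (σ' : Fin n' → QCDField Nf) (f' : Fin n' → SchwartzMap (EuclideanSpace ℝ (Fin 4)) ℝ) (F : SchwartzMap (Fin n' → EuclideanSpace ℝ (Fin 4)) ℂ), IsTensorOf F (fun i => ofRealTest (f' i)) → IsOffDiagonal F → Tendsto (fun k => qcdLatticeSchwinger (reg.scheme m z shift) (φ k) n' σ' f') atTop (𝓝 (T.schwinger n' σ' F))) ∧ T.IsNontrivial QCDField.glue ∧ T.IsNonGaussian QCDField.glue ∧ (∀ f g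 : Fin Nf, f ≠ g → T.IsNontrivial (QCDField.pseudoRe f g)) ∧ ∃ Δ > 0, T.HasMassGap Δ

/-- **Registered sub-goal `compactnessClosure_iff`**: the packaging abbreviation `CompactnessClosure` unfolds, definitionally, to the
closure clause of the compactness-ready bundle consumed by the landed diagonal step `stub_packageContinuum_of_compactnessReady`
(p163529) — so packaged and unpackaged stubs compose by `Iff.rfl`. -/
theorem compactnessClosure_iff : ∀ (Nf : ℕ) (reg : QCDRegularisation Nf) (ι : Type) (n : ι → ℕ) (σ : (i : ι) → Fin (n i) → QCDField Nf) (f : (i : ι) → Fin (n i) → SchwartzMap (EuclideanSpace ℝ (Fin 4)) ℝ) (m : Fin Nf → ℝ) (z shift : QCDField Nf → ℕ → ℝ), CompactnessClosure Nf reg n σ f m z shift ↔ (∀ φ : ℕ → ℕ, StrictMono φ → (∀ i, ∃ l : ℂ, Tendsto (fun k => qcdLatticeSchwinger (reg.scheme m z shift) (φ k) (n i) (σ i) (f i)) atTop (𝓝 l)) → ∃ T : OSData (QCDField Nf) 4, (∀ n' : ℕ, n' ≠ 0 → ∀ (σ' : Fin n' → QCDField Nf) (f' : Fin n' → SchwartzMap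 (EuclideanSpace ℝ (Fin 4)) ℝ) (F : SchwartzMap (Fin n' → EuclideanSpace ℝ (Fin 4)) ℂ), IsTensorOf F (fun i => ofRealTest (f' i)) → IsOffDiagonal F → Tendsto (fun k => qcdLatticeSchwinger (reg.scheme m z shift) (φ k) n' σ' f') atTop (𝓝 (T.schwinger n' σ' F))) ∧ T.IsNontrivial QCDField.glue ∧ T.IsNonGaussian QCDField.glue ∧ (∀ f g : Fin Nf, f ≠ g → T.IsNontrivial (QCDField.pseudoRe f g)) ∧ ∃ Δ > 0, T.HasMassGap Δ) :=
  fun _ _ _ _ _ _ _ _ _ => Iff.rfl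

end Summit.QuantumFields.QCD.Theorems.GoldstoneSplit

end
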